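import Summits.HodgeConjecture.HodgeConjecture.Theorems.F0D9opRoad2Descent
import Summits.HodgeConjecture.HodgeConjecture.Theorems.F0P6aModuliDatum
import HarnessLib

/-!
# `F0D9opRoad2Doors` — ★ RE-HOME of `Lines/F0_D9opRoad2.lean`, PART 5 of 6 (size-lint split; cut at a declaration boundary).

Imports (bare lines; provenance here): `Theorems.F0D9opRoad2Descent` = ★ the previous part of the same `Lines` workfile (size-lint split ×6) · ★ `…Theorems.F0P6aModuliDatum` (moved here from the ROOT header — «M-150f» (B): this is the only part that reads it) · `HarnessLib`.
See PART 1 `Theorems/F0D9opRoad2Boundary.lean` for the full re-home header and the original module docstring (verbatim there). Namespaces and sections KEPT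
(re-opened below exactly as they stand at the cut, with their `open`∕`variable` lines replayed); code bytes = the workfile՚s, docstrings included; options preamble repeated from PART 1.
HC_CM is proved only modulo the 7 printed citations (2 remaining: hLiu418 = stmt-HodgeConjecture-24832, h413 = stmt-HodgeConjecture-24833) until rung 0 closes; a re-home is count-neutral. -/

namespace Summit.HodgeConjecture.HodgeConjecture.Cruxes.HLiu418.F0D9opRoad2
set_option linter.dupNamespace false  -- `Summit.HodgeConjecture.HodgeConjecture.…` BY DESIGN (D-0017), as in `Lines/d6_cm_curve.lean`
open CategoryTheory NumberField IsDedekindDomain MulAction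
open scoped Matrix MonObj CategoryTheory.Obj
open MonoidalCategory
open Summit.HodgeConjecture.CorCM.Lines.A3Liu418
open Literature.AlgebraicGeometry.Motives (AbelianVariety)
open Literature.AlgebraicGeometry.Motives.AbelianVariety (rationalTateModuleMap frobeniusHom zsmul_eq_zsmul_trace_comp_of_pin
  exists_finite_forall_exists_goodReductionAt_homReduction_tateSpecialisation)
open Literature.NumberTheory.GaloisRepresentations
open Literature.NumberTheory.Automorphic Literature.NumberTheory.Automorphic.UnitaryGroup
open Literature.AlgebraicGeometry.ShimuraVarieties.UnitaryCanonicalModel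
open Literature.NumberTheory.Automorphic.Liu2021.AppendixC
open Literature.AlgebraicGeometry.Motives (AlgPoints IntegralModel frobeniusOver SchemeOver)
open Literature.NumberTheory.DiophantineGeometry (geomResidueField)

section Edition5Desk
open Literature.NumberTheory.EllipticCurves (genericFibre)
open Literature.NumberTheory.DiophantineGeometry (specialFibreFunctor)
open IsLocalRing (closedPoint)


/-- **PEN `stub_C3_of`** — the ED. 5 record bridge (M; F0P5a-p01 (g4) rows (b1) CORE-SET + (b1′) PEN, HOME desks): `S₃ :=` MOD՚s, `𝒮 :=` MOD՚s;
at `(N, r₁, r₂, x)` descend to `(Kc, N′, r̃₁, r̃₂, x′)` (`stub_desc`); `K₁ := Kc ⊓ C5.heckeLevel t₁ Kc` (open-compact bookkeeping), `ht₂` from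
DEG (c); the Γ3-Q lift at `(Kc, K₁, N′, r̃₁, x′)` is surjective (`stub_Q`) between finite types of cardinality `N w + 1` (DEG (a) at `Kc`, MOD (7))
hence bijective (`Fintype.bijective_iff_surjective_and_card`); ★ Γ3-A′ `IntegralModel.finsum_smul_geomReductionMap_map_eq_of_two_sections`
(p801437) with ★ `ncard_fibre_geomReductionMap_eq_one_of_isOpenImmersion_specialFibre` (p805580 §3) at `u x′` over MOD (1)(2)(4)(5)(6) gives
the C3 identity at `(Kc, 𝒮c, N′, r̃₁, r̃₂, x′)` (`r̃₂`-term: DEG (b) + ★ `heckeTranslate_unique`); push forward along `ū_v` by ★ C2a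
`IntegralModel.geomReductionMap_map` and ★ `AlgPoints.map_frobeniusOver_map`, reindex `∑ᶠ` along `e₁`, `e₂`.
(print: Liu2021, proof of Cor. D.9 p. 139 L4–L31) -/
theorem stub_C3_of :
    RecordCurveCongruenceCorrespondenceCofinal → HeckeSumReindexing → HeckeDegreeSplitPlace → HeckeMultisetLevelDescent →
      RecordNeatLevelFullFibres → letter_D8_heckeReductionPointwise := by
  intro hMOD hQ hDEG hDESC hFULL F _ _ _ _ ι₁ Jstar K₀ S hU7ₛ hJ hJu K
  obtain ⟨S₃, hS₃, hMODw⟩ := hMOD F ι₁ Jstar K₀ S hU7ₛ hJ hJu K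
  -- (no `fun … => ?_` inside `refine`: a delayed-assigned hole under binders over this goal costs > 200 k heartbeats)
  refine ⟨S₃, hS₃, ?_⟩
  intro w hwS hw hJi hK
  have hMODx := hMODw w hwS hw hJi hK
  obtain ⟨𝒮, h𝒮, Kc, hKcK, hKc, 𝒮c, h𝒮c, ū, hū, hMOD₁⟩ := hMODx
  refine ⟨𝒮, h𝒮, ?_⟩
  intro N hNK r₁ hr₁ hrN₁ r₂ hr₂ hrN₂ x
  haveI : AlgebraicGeometry.IsProper 𝒮.total.hom := h𝒮.2
  haveI : AlgebraicGeometry.IsProper 𝒮c.total.hom := h𝒮c.2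
  exact PenLemmas.congruenceOnPoints_at_of_letters hQ hDEG hDESC hFULL F ι₁ Jstar K₀ S hU7ₛ hJ hJu K w hw hJi hK 𝒮 Kc hKcK hKc 𝒮c ū hū
    hMOD₁ N hNK r₁ hr₁ hrN₁ r₂ hr₂ hrN₂ x

/-! ### ED. 5.3 — THE LIBERALISED MOD LETTER (F0P5a-plan (g4), 2026-08-31; HOME DESK ONLY): `RecordCurveCongruenceOnPointsCofinal` (MODv3 = the C3
identity AT A COFINAL `w`-hyperspecial sublevel `Kc ≤ K` + a model morphism `ū : 𝒮c ⟶ 𝒮` onto a smooth proper model of `M⋆_K`) sits BETWEEN the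
print-shape boundary MODv2 (`RecordCurveCongruenceCorrespondenceCofinal`, two-section datum) and the registered residual `stub_C3`:
`MODv2 → Γ3-Q → DEG → FULL → MODv3` (`modv3_of_modv2` = the CORE half of the PEN at level `Kc`, §2 `PenLemmas.finsum_translate_eq_of_two_sections`)
and `MODv3 → DESC → letter_D8` (`stub_C3_of_v3` = push-forward + reindex, ★ p808737 `IntegralModel.finsum_congruence_pushforward_reindex` ∕
CERT-ED5-Descent caae2901).  ROAD-NEUTRAL: R-RSZ (MOD-PLAN v0.9 Rows 1–6 + L5.4) delivers MODv2 and enters through `modv3_of_modv2`; Road P″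
(«spread-out characteristic-0 moduli + pointwise finite flat subgroup schemes», memo `F0/P5a/MOD-ROAD-Pprime.v0.F0P5a-plan-g4.md`) delivers MODv3
DIRECTLY; P5a is not re-plumbed either way.  Residual of record UNCHANGED (tree ED. 4: `stub_C3`; desk: `stub_MOD`); rows (b14) (b15) are HOME
desk pens (record currency, s422 (b)); desk v0.8 flips `stub_C3 := stub_C3_of_v3 stub_MODv3 stub_desc` once both are sorry-free. -/

/-- **PEN′ `modv3_of_modv2`** (row (b15), F0P5a-p03 (g4); S–M, ≈ 120 lines): `S₃, 𝒮, Kc, 𝒮c, ū :=` MOD՚s; at each `(N′, r̃₁, r̃₂, x′)` at level `Kc`: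
`K₁ := Kc ⊓ C5.heckeLevel t₁ Kc` (★ p809676 `SmallLevelInfConj`, as in `PenLemmas.congruenceOnPoints_at_of_letters`), `ht₂` from DEG (c), the Γ3-Q
lift (`hQ` at `(Kc, K₁, N′, r̃₁, x′)`) is surjective between finite types of cardinal `N w + 1` (DEG (a) at `Kc`; FULL + ★ p810526
`relIndex_inf_map_conj_eq_natCard_orbit`) hence bijective (`Function.Surjective.bijective_of_nat_card_le`), and §2 CORE
`PenLemmas.finsum_translate_eq_of_two_sections` over MOD (1)(2)(4)(5)(6) IS the identity at `(Kc, 𝒮c, N′, r̃₁, r̃₂, x′)` — i.e. the body of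
`PenLemmas.congruenceOnPoints_at_of_descent` up to `have core := …`, with the push-forward deleted and `(N, r₁, r₂, x, e₁, e₂, hT₁, hT₂)` absent.
[cite: Liu2021, Prop. D.8 (1)–(3) and proof of Cor. D.9 p. 139 L4–L31] -/
theorem modv3_of_modv2 :
    RecordCurveCongruenceCorrespondenceCofinal → HeckeSumReindexing → HeckeDegreeSplitPlace → RecordNeatLevelFullFibres →
      RecordCurveCongruenceOnPointsCofinal := by
  intro hMOD hQ hDEG hFULL F _ _ _ _ ι₁ Jstar K₀ S hU7ₛ hJ hJu K
  obtain ⟨S₃, hS₃, hMODw⟩ := hMOD F ι₁ Jstar K₀ S hU7ₛ hJ hJu K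
  -- (no `fun … => ?_` inside `refine`, and no trailing `?_` under the 9-deep constructor: stage B′ is a Π-lemma, closed in one `exact`)
  refine ⟨S₃, hS₃, ?_⟩
  intro w hwS hw hJi hK
  have hMODx := hMODw w hwS hw hJi hK
  obtain ⟨𝒮, h𝒮, Kc, hKcK, hKc, 𝒮c, h𝒮c, ū, hū, hMOD₁⟩ := hMODx
  haveI : AlgebraicGeometry.IsProper 𝒮c.total.hom := h𝒮c.2
  exact ⟨𝒮, h𝒮, Kc, hKcK, hKc, 𝒮c, h𝒮c, ū, hū,
    PenLemmas.congruenceOnPointsCofinal_block_of_letters hQ hDEG hFULL F ι₁ Jstar K₀ S hU7ₛ hJ hJu w hw hJi Kc hKc 𝒮c hMOD₁⟩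

/-- **PEN′ `stub_C3_of_v3`** (row (b14), F0P5a-p02 (g4); S, ≈ 60 lines): `S₃ :=` MODv3՚s, `𝒮 :=` MODv3՚s (α); at `(N, r₁, r₂, x)` descend by `hDESC`
at `(K, Kc)` to `(N′, x′, r̃₁, r̃₂, e₁, e₂)` with the two translate identities, take the MODv3 identity (γ″) at `(N′, r̃₁, r̃₂, x′)`, push it forward
along `ū_v` (β′) and reindex along `e₁ e₂`: ONE call of ★ p808737 `Literature.AlgebraicGeometry.Motives.IntegralModel.finsum_congruence_pushforward_reindex`
followed by the three `congrArg` rewrites `hL hA hR` of `PenLemmas.congruenceOnPoints_at_of_descent` (or paste `ED5Desk.congruenceOnPoints_of_levelDescent`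
of CERT-ED5-Descent caae2901 line-locally and apply it).  NB the `∃`-plumbing discipline of §4 (no `fun … => ?_` holes inside `refine`).
[cite: Liu2021, proof of Cor. D.9 p. 139 L4–L31] [cite: Milne2005ShimuraVarieties, §5 p. 57–58, Thm. 13.6] -/
theorem stub_C3_of_v3 :
    RecordCurveCongruenceOnPointsCofinal → HeckeMultisetLevelDescent → letter_D8_heckeReductionPointwise := by
  intro hMOD hDESC F _ _ _ _ ι₁ Jstar K₀ S hU7ₛ hJ hJu K
  obtain ⟨S₃, hS₃, hMODw⟩ := hMOD F ι₁ Jstar K₀ S hU7ₛ hJ hJu K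
  -- (no `fun … => ?_` inside `refine`: a delayed-assigned hole under binders over this goal costs > 200 k heartbeats)
  refine ⟨S₃, hS₃, ?_⟩
  intro w hwS hw hJi hK
  have hMODx := hMODw w hwS hw hJi hK
  obtain ⟨𝒮, h𝒮, Kc, hKcK, hKc, 𝒮c, h𝒮c, ū, hū, hC3c⟩ := hMODx
  refine ⟨𝒮, h𝒮, ?_⟩
  intro N hNK r₁ hr₁ hrN₁ r₂ hr₂ hrN₂ x
  haveI : AlgebraicGeometry.IsProper 𝒮.total.hom := h𝒮.2
  haveI : AlgebraicGeometry.IsProper 𝒮c.total.hom := h𝒮c.2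
  have hDESCx := hDESC F ι₁ Jstar K₀ S hU7ₛ hJ hJu K w hw hJi hK Kc hKcK hKc N hNK r₁ hr₁ hrN₁ r₂ hr₂ hrN₂ x
  obtain ⟨N', hN'N, hN'Kc, x', hx', rc₁, hrc₁, hrcN₁, rc₂, hrc₂, hrcN₂, e₁, e₂, hT₁, hT₂⟩ := hDESCx
  exact DescentLemmas.congruenceOnPoints_of_levelDescent S hU7ₛ hJ hJu hKcK w hw 𝒮 𝒮c ū hū N hNK r₁ hrN₁ r₂ hrN₂ x N' hN'N hN'Kc
    x' hx' rc₁ hrcN₁ rc₂ hrcN₂ e₁ e₂ hT₁ hT₂ (hC3c N' hN'Kc rc₁ hrc₁ hrcN₁ rc₂ hrc₂ hrcN₂ x')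

/-- **`stub_MODv3 : RecordCurveCongruenceOnPointsCofinal`** — the ROAD-NEUTRAL MOD boundary, DERIVED at ED. 6 through the door P″
(`modv3_of_core_quot stub_PWcore stub_MODquot`, module `Lines/F0D9opRoad2Mod.lean`; was `modv3_of_modv2 stub_MOD stub_Q stub_deg stub_full` at ED. 5 —
door R, whose glue `modv3_of_modv2`∕`stub_Q`∕`stub_deg`∕`stub_full` stays PROVED below and above).  `stub_C3 := stub_C3_of_v3 stub_MODv3 stub_desc` unchanged.
[cite: Liu2021, Prop. D.8 (1)–(3) p. 135] -/
theorem stub_MODv3 : RecordCurveCongruenceOnPointsCofinal :=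
  modv3_of_core_quot Summit.HodgeConjecture.HodgeConjecture.Cruxes.HLiu418.F0P6aModuliDatum.pwcore_holds
    Summit.HodgeConjecture.HodgeConjecture.Cruxes.HLiu418.F0P6qTameLevelQuotient.quot_holds

/-- **`modv3_of_c3`** (F0P5a-ref1 (g0) 05:26:16Z FINDING in kernel form; F0P5a-p02 (g4) cert §4, default heartbeats): the liberalised MOD
letter is implied by C3 itself — `Kc := K`, `𝒮c := 𝒮`, `ū := 𝟙` (`hū` by `CategoryTheory.Functor.map_id` ∕ `homOfLE_refl`), (γ″) := C3՚s own block.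
Hence MODv3 ≡ `stub_C3` modulo the (proved) DESC letter: a WAYPOINT of the line, never its boundary. [cite: Liu2021, proof of Cor. D.9 p. 139 L4–L31] -/
theorem modv3_of_c3 : RecordCurveCongruenceOnPoints → RecordCurveCongruenceOnPointsCofinal := by
  intro hC3 F _ _ _ _ ι₁ Jstar K₀ S hU7ₛ hJ hJu K
  obtain ⟨S₃, hS₃, hC3w⟩ := hC3 F ι₁ Jstar K₀ S hU7ₛ hJ hJu K
  refine ⟨S₃, hS₃, ?_⟩
  intro w hwS hw hJi hK
  have hC3x := hC3w w hwS hw hJi hK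
  obtain ⟨𝒮, h𝒮, hC3K⟩ := hC3x
  have hū : (genericFibre (HeightOneSpectrum.valuationSubringAtPrime F w) F).map (𝟙 𝒮.total) ≫ 𝒮.genericIso'.hom
      = 𝒮.genericIso'.hom ≫ S.M.map (homOfLE (le_refl K)) := by
    simp only [CategoryTheory.Functor.map_id, Category.id_comp, homOfLE_refl, Category.comp_id]
  exact ⟨𝒮, h𝒮, K, le_refl K, hK, 𝒮, h𝒮, 𝟙 𝒮.total, hū, hC3K⟩

/-- **CONVERSE `modv3_of_letterD8`** (sanity, F0P5a-plan (g4); v0.8: the term `modv3_of_c3`, default heartbeats): the registered residual implies MODv3 with `Kc := K`, `𝒮c := 𝒮`, `ū := 𝟙`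
— so MODv3 is `letter_D8` up to the record descent `stub_desc`, not a strengthening. [cite: Liu2021, proof of Cor. D.9 p. 139] -/
theorem modv3_of_letterD8 : letter_D8_heckeReductionPointwise → RecordCurveCongruenceOnPointsCofinal :=
  modv3_of_c3

end Edition5Desk

/-- **STUB `stub_C3 : letter_D8_heckeReductionPointwise` — ED. 5 DESK: NOW A DEFINITION** over the four ED. 5 letters and the pen
(`stub_C3_of stub_MOD stub_Q stub_deg stub_desc`); ED. 4 text: THE BOUNDARY of D9op road 2′ = the open printed letter D.8
(director s366 R1, s392 (1), s396 (1): printed inputs enter FLOOR 0 as registered stubs of the line, never as consumed Literature facts; XL;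
discharged only by the MOD programme P6 if the human opens it — until then P5a carries it as its FLOOR-0 residual).
(print: Liu2021, Prop. D.8 (1)–(3) + proof of Cor. D.9 p. 139; Carayol1986Compositio, Prop. 10.3) -/
theorem stub_C3 : letter_D8_heckeReductionPointwise :=
  stub_C3_of_v3 stub_MODv3 stub_desc

/-- **LETTER C1b — `RecordCurveAlbaneseTrace`** (hand-back §1 form; F0P5a-p01 (g0) closes): for every record datum with LEVEL QUOTIENTS (`hLQ`) and
small `N ⊆ K` with `N` normalised by `K`, there are a finite index type `Δ` (the group `K∕N`), automorphisms `act δ` of `M⋆_N` OVER `M⋆_K`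
(`act δ ≫ u = u`), and an Albanese TRACE `t : A_K → A_N` with `Alb(u) ≫ t = Σ_δ Alb(act δ)` ([Lang1983AbelianVarieties] VIII §6 Thm. 13; ★
`Albanese.exists_trace_of_isSepQuotient`) and `t ≫ Alb(u) = |Δ| • 𝟙` (★ `Albanese.trace_comp_map_eq_card_smul`), `0 < |Δ|`.  The second conjunct
is the hypothesis `ht` of ★ C1 `HeckeTranslates.comp_nablaTr_comp_α_comp_trace_sum_albTr` (p793039), the third the `htr` of `stub_C`.  NOT asserted
here: `stub_C1b`. (print: Lang1983AbelianVarieties, Ch. VIII §6 Thm. 13 (pp. 224–227)) (print: Liu2021, §2.1 Proposition and Def. 2.3 (FJcycle.tex l. 1190–1208)) -/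
def RecordCurveAlbaneseTrace : Prop :=
  ∀ (F : Type) [Field F] [NumberField F] [IsCMField F] (ι₁ : F →+* ℂ) (Jstar : Matrix (Fin 2) (Fin 2) F)
    (K₀ : C5.OpenCompactSubgroup ↥(finAdelic ↥(maximalRealSubfield F) F (IsCMField.complexConj F) 2 Jstar))
    (S : RecordSystemGS F Jstar ι₁ K₀) (_hU7ₛ : S.HeckeTranslateDefinedOver) (_hLQ : S.IsLevelQuotient)
    (h4 : 4 ≤ Module.finrank ℚ F) (isoₛ : ℕ → Prop)
    (N K : C5.SmallLevel K₀) (hNK : N ≤ K), (∀ k ∈ K.1.1, C5.HeckeLE k N N) →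
    ∃ (Δ : Type) (_ : Fintype Δ) (act : Δ → ((CMgsm F ι₁ Jstar K₀ S h4 isoₛ).X N ⟶ (CMgsm F ι₁ Jstar K₀ S h4 isoₛ).X N)) (t : (CMgsm F ι₁ Jstar K₀ S h4 isoₛ).A K ⟶ (CMgsm F ι₁ Jstar K₀ S h4 isoₛ).A N),
      (∀ δ, act δ ≫ (CMgsm F ι₁ Jstar K₀ S h4 isoₛ).cpt.X.map (homOfLE hNK) = (CMgsm F ι₁ Jstar K₀ S h4 isoₛ).cpt.X.map (homOfLE hNK)) ∧
      (CMgsm F ι₁ Jstar K₀ S h4 isoₛ).Atr (homOfLE hNK) ≫ t = ∑ δ, ((CMgsm F ι₁ Jstar K₀ S h4 isoₛ).alb N).map ((CMgsm F ι₁ Jstar K₀ S h4 isoₛ).alb N) (act δ) ∧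
      t ≫ (CMgsm F ι₁ Jstar K₀ S h4 isoₛ).Atr (homOfLE hNK) = (Fintype.card Δ : ℤ) • 𝟙 ((CMgsm F ι₁ Jstar K₀ S h4 isoₛ).A K) ∧ 0 < Fintype.card Δ

/-- **`stub_C1b : RecordCurveAlbaneseTrace` — DISCHARGED** by ★ p795546 `Sec42Data.HeckeTranslates.exists_albaneseTrace_of_levelQuotientUP`
(F0P5a-p01 (g2)) at `T := sec42HeckeTranslatesGSM …`, `hUP := levelQuotientUP_GSM …` (u1 + u4). [cite: Lang1983AbelianVarieties, Ch. VIII §6 Thm. 13 (pp. 224–227)] -/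
theorem stub_C1b : RecordCurveAlbaneseTrace :=
  fun _F _ _ _ _ι₁ _Jstar _K₀ S hU7ₛ hLQ h4 isoₛ _N _K hNK hn =>
    (Literature.NumberTheory.Automorphic.Liu2021.AppendixC.sec42HeckeTranslatesGSM S hU7ₛ h4 isoₛ).exists_albaneseTrace_of_levelQuotientUP
      hNK hn (Literature.NumberTheory.Automorphic.Liu2021.AppendixC.levelQuotientUP_GSM S hU7ₛ hLQ h4 isoₛ hNK hn)

/-- **SUPPORT LETTER U — `RecordNablaTrSurjective`** (hand-back §1): the restricted transition `∇u^N_K : ∇M⋆_N → ∇M⋆_K` is SURJECTIVE on points over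
any algebraically closed field (★ `Nabla.surjective_map_left` + ★ `AlgPoints.map_surjective_of_surjective_of_isAlgClosed`, given that the record
transition `u^N_K` is surjective, universally closed and universally open — finite étale quotient map, [Liu2021] §C.3 (F2)).  NOT asserted here: `stub_U`.
(print: Liu2021, Def. 2.1 (1) (FJcycle.tex l. 1174) and App. C (F2) (l. 4656–4660)) -/
def RecordNablaTrSurjective : Prop :=
  ∀ (F : Type) [Field F] [NumberField F] [IsCMField F] (ι₁ : F →+* ℂ) (Jstar : Matrix (Fin 2) (Fin 2) F)
    (K₀ : C5.OpenCompactSubgroup ↥(finAdelic ↥(maximalRealSubfield F) F (IsCMField.complexConj F) 2 Jstar))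
    (S : RecordSystemGS F Jstar ι₁ K₀) (_hLQ : S.IsLevelQuotient) (h4 : 4 ≤ Module.finrank ℚ F) (isoₛ : ℕ → Prop)
    (N K : C5.SmallLevel K₀) (hNK : N ≤ K) (Ω : Type) [Field Ω] [Algebra F Ω] [IsAlgClosed Ω],
    Function.Surjective (Literature.AlgebraicGeometry.Motives.AlgPoints.map (L := Ω) ((CMgsm F ι₁ Jstar K₀ S h4 isoₛ).nablaTr (homOfLE hNK)))

/-- **`stub_U : RecordNablaTrSurjective` — DISCHARGED INLINE** over ★ p795322 `NablaMapGeometricPointsLift` (A-p07 (g17) cert 708a8943: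
the record՚s `pieces_pair_lift` + `Sec42Data.exists_comp_nablaTr_eq_algPoints_of_pieces_lift`). [cite: Liu2021, App. C (F2) (FJcycle.tex l. 4656–4660)] -/
theorem stub_U : RecordNablaTrSurjective := by
  intro F _ _ _ ι₁ Jstar K₀ S _hLQ h4 isoₛ N K hNK Ω _ _ _ Pt
  letI : Algebra F ℂ := ι₁.toAlgebra
  obtain ⟨κ, κ', P, P', inj, hP, hcol, inj', hP', hl⟩ := S.pieces_pair_lift (homOfLE hNK)
  haveI := hP
  haveI := hP'
  exact (Literature.NumberTheory.Automorphic.Liu2021.AppendixC.sec42DataGSM S h4 isoₛ).exists_comp_nablaTr_eq_algPoints_of_pieces_lift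
    (homOfLE hNK) inj hcol inj' hl Ω Pt

/-- **SUPPORT LETTER π0 — `SmoothProperModelSeparatesNabla`** (hand-back §1; planner π0-a∕b∕c): for a smooth projective `X` over a number field, any
`∇`-datum `N` and a smooth proper model `𝒮` of `X` at `w`, two geometric points of `X` with the SAME reduction lie over a point of `∇X` (same
geometric connected component; Zariski connectedness ∕ Stein factorisation for the proper smooth `𝒮`, [Hartshorne1977] III Cor. 11.3, and
`∇X` = «same component» [Liu2021] Def. 2.1 (1)).  NOT asserted here: `stub_π0`. (print: Hartshorne1977, III Cor. 11.3 and Cor. 11.5 (pp. 279–280))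
(print: Liu2021, Def. 2.1 (1) (FJcycle.tex l. 1174)) -/
def SmoothProperModelSeparatesNabla : Prop :=
  ∀ (F : Type) [Field F] [NumberField F] (w : HeightOneSpectrum (𝓞 F)) (X : Literature.AlgebraicGeometry.Motives.SchemeOver F) (d : ℕ)
    [AlgebraicGeometry.SmoothOfRelativeDimension d X.hom] (_hX : Literature.AlgebraicGeometry.Motives.IsProjectiveOver X)
    (N : Literature.NumberTheory.Automorphic.Liu2021.AppendixC.Nabla X)
    (𝒮 : Literature.AlgebraicGeometry.Motives.IntegralModel (HeightOneSpectrum.valuationSubringAtPrime F w) F X) (h𝒮 : 𝒮.IsSmoothProper d)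
    (p p' : Literature.AlgebraicGeometry.Motives.AlgPoints X (AlgebraicClosure (w.adicCompletion F))),
    (haveI : AlgebraicGeometry.IsProper 𝒮.total.hom := h𝒮.2
     𝒮.geomReductionMap p = 𝒮.geomReductionMap p') →
    ∃ z : Literature.AlgebraicGeometry.Motives.AlgPoints N.N (AlgebraicClosure (w.adicCompletion F)), z ≫ N.incl = CartesianMonoidalCategory.lift p p'

/-- **`stub_π0 : SmoothProperModelSeparatesNabla` — DISCHARGED** by ★ p796906 `Nabla.exists_comp_incl_eq_lift_of_geomReductionMap_eq` (F0P5a-p04 (g0):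
generization on the smooth proper model; it needs neither projectivity nor the dimension binder, which are simply dropped).
[cite: Hartshorne1977, III Cor. 11.3 and Cor. 11.5 (pp. 279–280)] -/
theorem stub_π0 : SmoothProperModelSeparatesNabla :=
  fun _F _ _ _w _X _d _ _hX N 𝒮 h𝒮 p p' hp =>
    Literature.NumberTheory.Automorphic.Liu2021.AppendixC.Nabla.exists_comp_incl_eq_lift_of_geomReductionMap_eq N 𝒮 h𝒮 p p' hp

/-- **SUPPORT LETTER Fr — `FrobeniusLiftOnReduction`** (hand-back §1): there is an element `σ` of the absolute Galois group of the completion `F_w`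
(an arithmetic Frobenius of the decomposition group) such that for every proper integral model `𝒳` at `w` and every geometric point `x`,
`red_𝒳 (σ • x) = F (red_𝒳 x)` with `F` the `q`-Frobenius of the special fibre (★ `frobeniusOver`; valuative criterion + `σ` inducing `Frob_q` on
`κ̄(w)`: [SerreTate1968] §1, ★ pattern `reducePointMonoidHom_left_eq_frobenius_comp_of_frobeniusAt`).  NOT asserted here: `stub_Fr`.
(print: SerreTate1968, §1 (the reduction map and its Galois equivariance)) -/
def FrobeniusLiftOnReduction : Prop :=
  ∀ (F : Type) [Field F] [NumberField F] (w : HeightOneSpectrum (𝓞 F)),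
    ∃ σ : Field.absoluteGaloisGroup (w.adicCompletion F),
      ∀ (X : Literature.AlgebraicGeometry.Motives.SchemeOver F)
        (𝒳 : Literature.AlgebraicGeometry.Motives.IntegralModel (HeightOneSpectrum.valuationSubringAtPrime F w) F X) [AlgebraicGeometry.IsProper 𝒳.total.hom]
        (x : Literature.AlgebraicGeometry.Motives.AlgPoints X (AlgebraicClosure (w.adicCompletion F))),
        𝒳.geomReductionMap (σ • x) =
          Literature.AlgebraicGeometry.Motives.AlgPoints.map (Literature.AlgebraicGeometry.Motives.frobeniusOver 𝒳.reductionAt) (𝒳.geomReductionMap x)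

/-- **`stub_Fr : FrobeniusLiftOnReduction` — DISCHARGED** by ★ p796419 `IntegralModel.exists_forall_geomReductionMap_smul_eq_map_frobeniusOver` (F0P5a-p05 (g0):
any arithmetic Frobenius of the local field, ★ `exists_isAbsArithFrob_holds`, over the Γ-equivariance of the plain reduction ★ p795656 §4, A-p03 (g16)).
[cite: SerreTate1968, §1 (the reduction map and its Galois equivariance)] -/
theorem stub_Fr : FrobeniusLiftOnReduction :=
  fun F _ _ w => Literature.AlgebraicGeometry.Motives.IntegralModel.exists_forall_geomReductionMap_smul_eq_map_frobeniusOver F w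

/-! ### `stub_C` from the six letters — THE ED. 4 COMPOSITION (pen: F0P5a-p05 (g0), LEAD WORD #10; hand-back memo §2 steps 1–6 BY NAME). -/

set_option maxHeartbeats 400000 in
/-- **ED. 4 composition `stub_C_of` — the pole from the six letters.**  Exceptional set `S₃ := S₃(C3) ∪ S_𝒜` (★
`exists_finite_forall_exists_isAbelianSchemeModel` on `A_K`).  At `w ∉ S₃`: `𝒮` := C3՚s OWN smooth proper model (C3 is `∃ 𝒮`; everything is built on
it), `𝒜` the abelian-scheme model, `αd` := the extension of `α_K` by `1` off the clopen `∇M⋆_K` (★ `exists_desc_eq_one_of_isClopen`, BOTH conjuncts),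
`𝔞` := its Néron extension ON `𝒮 ⊗ 𝒮` (★ `IsAbelianSchemeModel.exists_tensor_genericFibre_map_eq`); `(d, t) := (|Δ|, t)` from C1b (its third conjunct is
`htr`).  For `z`: the two `K`-orbits are finite (★ `finite_orbit_level`) so `∑ᶠ = ∑`; then ★ `Sec42Data.HeckeTranslates.eichlerShimura_pointwise_of_congruence`
(F0P5a-p05 (g0): H + pairs → `z = red(x, y)`; `F`-linearity ★ `SpecialFibreFrobeniusPoints`; off `∇`: `αd = 1`; on `∇`: U-lift, ★ C1 on the `∇_N`-lift, reduction
through `𝔞` ★ `IntegralModelReductionMapAbelianScheme` + ★ `…prod_finsetProd`, and per deck transformation Bk3 ★ `EichlerShimuraAssembly.sum_pairing_eq_of_multiset_eq_of_rel`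
with the `∇`-relation — cocycle ★ `Albanese.isCocycle_of_isProjectiveOver`, transitivity ★, π0 — fed with C3 at `δ x̃`, `δ ỹ` and the Frobenius twists realised by `σ` (Fr))
at `T := sec42HeckeTranslatesGSM`, `f := homOfLE hNK`, `q := N w`, with H at `𝒮` (flat since smooth), U, π0 at `(M⋆_K, ∇, 𝒮)`, Fr՚s `σ` at `𝒮`, and C3՚s identity
with `∑ᶠ` read as `∑`.  [cite: Liu2021, Prop. D.8 (1)–(3) and Cor. D.9 proof (FJcycle.tex l. 5579–5600; print p. 139)] [cite: DiamondShurman2005, Thm. 8.7.2 (p. 353)] -/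
theorem stub_C_of (hH : ProperFlatModelReductionSurjective) (hC1b : RecordCurveAlbaneseTrace) (hC3 : RecordCurveCongruenceOnPoints)
    (hU : RecordNablaTrSurjective) (hπ0 : SmoothProperModelSeparatesNabla) (hFr : FrobeniusLiftOnReduction) :
    RecordCurveEichlerShimuraPointwise := by
  intro F _ _ _ _ ι₁ Jstar K₀ S hU7ₛ hLQ h4 isoₛ hJ hJu K
  classical
  letI : Algebra F ℂ := ι₁.toAlgebra
  -- the exceptional set: C3՚s, and the bad places of one abelian-scheme model of `A_K` (term-mode `.elim`: no `obtain` motive over the big goal)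
  refine (hC3 F ι₁ Jstar K₀ S hU7ₛ hJ hJu K).elim fun S₃ hS₃ => ?_
  refine (Literature.AlgebraicGeometry.Motives.AbelianVariety.exists_finite_forall_exists_isAbelianSchemeModel
    ((CMgsm F ι₁ Jstar K₀ S h4 isoₛ).A K)).elim fun S₁ hS₁ => ?_
  refine ⟨S₃ ∪ S₁, hS₃.1.union hS₁.1, ?_⟩
  intro w hw₀ hw hunit hhyp
  -- C3՚s model `𝒮`, the abelian-scheme model `𝒜`, the clopen extension `αd`, the Néron extension `𝔞`
  refine (hS₃.2 w (fun h' => hw₀ (Or.inl h')) hw hunit hhyp).elim fun 𝒮 h𝒮' => h𝒮'.elim fun h𝒮 hcong => ?_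
  refine (hS₁.2 w (fun h' => hw₀ (Or.inr h'))).elim fun 𝒜 h𝒜 => h𝒜.elim fun instG h => ?_
  haveI : AlgebraicGeometry.IsOpenImmersion ((CMgsm F ι₁ Jstar K₀ S h4 isoₛ).alb K).nabla.incl.left :=
    ((CMgsm F ι₁ Jstar K₀ S h4 isoₛ).alb K).nabla.isOpenImmersion_incl
  haveI : AlgebraicGeometry.IsClosedImmersion ((CMgsm F ι₁ Jstar K₀ S h4 isoₛ).alb K).nabla.incl.left :=
    ((CMgsm F ι₁ Jstar K₀ S h4 isoₛ).alb K).nabla.isClosedImmersion_incl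
  refine (Literature.AlgebraicGeometry.Motives.exists_desc_eq_one_of_isClopen ((CMgsm F ι₁ Jstar K₀ S h4 isoₛ).alb K).nabla.incl
    (G := ((CMgsm F ι₁ Jstar K₀ S h4 isoₛ).A K).X) ((CMgsm F ι₁ Jstar K₀ S h4 isoₛ).alb K).α).elim fun αd hαd => ?_
  refine (h.exists_tensor_genericFibre_map_eq 𝒮 h𝒮 αd h.exists_iso.choose).elim fun 𝔞 h𝔞 => ?_
  refine ⟨𝒜, instG, h, 𝒮, h𝒮, αd, hαd.1, 𝔞, h𝔞, ?_⟩
  intro N hNK hn r₁ hr₁ hrN₁ r₂ hr₂ hrN₂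
  -- C1b: the deck transformations and the Albanese trace
  refine (hC1b F ι₁ Jstar K₀ S hU7ₛ hLQ h4 isoₛ N K hNK hn).elim fun Δ hΔ' => hΔ'.elim fun instΔ hΔ'' => hΔ''.elim fun act hΔ3 =>
    hΔ3.elim fun t ht' => ?_
  obtain ⟨hact, ht, htr, hΔ⟩ := ht'
  refine ⟨(Fintype.card Δ : ℤ), t, by exact_mod_cast hΔ.ne', htr, fun z => ?_⟩
  -- the two `K`-orbits are finite: `∑ᶠ = ∑`
  have hfin₁ := Sec42Data.BettiPinning.finite_orbit_level (C := CMgsm F ι₁ Jstar K₀ S h4 isoₛ) K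
    (UnitaryGroup.heckeElementAt ↥(maximalRealSubfield F) F (IsCMField.complexConj F) 2 Jstar
      (⟨w, rfl⟩ : UnitaryGroup.PlacesOver F (w.under (𝓞 ↥(maximalRealSubfield F))))
      (IsCMField.complexConj_ne_one F) hJ hw (UnitaryGroup.isUnit_placeForm Jstar hJu w) (HeckeCharacter.uniformizer F w) 1)
  have hfin₂ := Sec42Data.BettiPinning.finite_orbit_level (C := CMgsm F ι₁ Jstar K₀ S h4 isoₛ) K
    (UnitaryGroup.heckeElementAt ↥(maximalRealSubfield F) F (IsCMField.complexConj F) 2 Jstar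
      (⟨w, rfl⟩ : UnitaryGroup.PlacesOver F (w.under (𝓞 ↥(maximalRealSubfield F))))
      (IsCMField.complexConj_ne_one F) hJ hw (UnitaryGroup.isUnit_placeForm Jstar hJu w) (HeckeCharacter.uniformizer F w) 2)
  haveI := hfin₁.fintype
  haveI := hfin₂.fintype
  rw [finsum_eq_sum_of_fintype, finsum_eq_sum_of_fintype]
  -- the instances of the six letters at `(𝒮, ∇M⋆_K, σ)`
  haveI : AlgebraicGeometry.IsProper 𝒮.total.hom := h𝒮.2
  haveI : AlgebraicGeometry.SmoothOfRelativeDimension 1 𝒮.total.hom := h𝒮.1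
  haveI : AlgebraicGeometry.Smooth 𝒮.total.hom := AlgebraicGeometry.SmoothOfRelativeDimension.smooth 1 _
  haveI : AlgebraicGeometry.SmoothOfRelativeDimension 1 ((CMgsm F ι₁ Jstar K₀ S h4 isoₛ).X K).hom := (CMgsm F ι₁ Jstar K₀ S h4 isoₛ).cpt.smooth_X K
  obtain ⟨σ, hσ⟩ := hFr F w
  exact (Literature.NumberTheory.Automorphic.Liu2021.AppendixC.sec42HeckeTranslatesGSM S hU7ₛ h4 isoₛ).eichlerShimura_pointwise_of_congruence w
    (homOfLE hNK) h 𝒮 αd hαd.1 (fun P hP => hαd.2 P hP) 𝔞 h𝔞 act hact t ht (fun α => r₁ α) hrN₁ (fun α => r₂ α) hrN₂ (Ideal.absNorm w.asIdeal)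
    (hH F w _ 𝒮) (hU F ι₁ Jstar K₀ S hLQ h4 isoₛ N K hNK _)
    (fun p p' hp => hπ0 F w _ 1 ((CMgsm F ι₁ Jstar K₀ S h4 isoₛ).cpt.projective_X K) _ 𝒮 h𝒮 p p' hp)
    σ (fun x => hσ _ 𝒮 x)
    (fun x => by
      have hc := hcong N hNK r₁ hr₁ hrN₁ r₂ hr₂ hrN₂ x
      rw [finsum_eq_sum_of_fintype, finsum_eq_sum_of_fintype] at hc
      exact hc)
    z

/-- **`stub_C : RecordCurveEichlerShimuraPointwise` — edition 4: a THEOREM over the six letters** (`stub_C_of`; five of them ★, the sixth is the boundary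
`stub_C3 = letter_D8_heckeReductionPointwise`). [cite: Liu2021, Prop. D.8 (1)–(3) and Cor. D.9 proof (FJcycle.tex l. 5586–5600)] -/
theorem stub_C : RecordCurveEichlerShimuraPointwise :=
  stub_C_of stub_H stub_C1b stub_C3 stub_U stub_π0 stub_Fr

end Summit.HodgeConjecture.HodgeConjecture.Cruxes.HLiu418.F0D9opRoad2
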